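import Mathlib
import Summits.NavierStokesRegularity.NavierStokesRegularity.Theses.AxisymmetricExtremality
import Literature.Analysis.FluidPDE.KatoMaximalTime
import Literature.Analysis.FluidPDE.AxisymmetricEuler

/-!
# Strategist s16-g5 — typed candidates for the STRATEGY CENSUS of crux `AxisymmetricKatoGlobal`
(item stmt-NavierStokesRegularity-15453, route AxisymmetricExtremality).

Nothing here is a route item or a stub of a registered line; these are the SIGNATURES the census
discusses (weaker intermediate W₀, split pieces A/B, strengthenings S⁺), with the pure-logic
relations among them and the route's `closes` re-glued from W₀.  No `sorry`.
-/

noncomputable section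

open Set MeasureTheory Filter Topology Function
open Literature.Analysis.FluidPDE Literature.Analysis.FunctionSpaces

namespace Summit.NavierStokesRegularity.NavierStokesRegularity.Cruxes.AxisymmetricKatoGlobal.StrategistS16g5

open Summit.NavierStokesRegularity.NavierStokesRegularity.Theses.AxisymmetricExtremality

local notation "ℝ³" => EuclideanSpace ℝ (Fin 3)

/-! ## 1. Weaker intermediate: the threshold instance W₀ actually consumed by `closes` -/

/-- W₀: for every ν > 0 there is NO axisymmetric Ḣ^{1/2}-minimal blow-up datum. -/
def NoAxisymMinimalBlowupDatum : Prop :=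
  ∀ ν : ℝ, 0 < ν → ¬ ∃ (u₀ : ℝ³ → ℝ³) (g : HomSobolev ℝ³ (EuclideanSpace ℂ (Fin 3)) (1 / 2 : ℝ)),
    IsMinimalBlowupDatum ν u₀ g ∧ IsAxisymmetric u₀

/-- The crux implies W₀ (pure logic: a minimal blow-up datum has no global Kato solution). -/
theorem noAxisymMinimalBlowupDatum_of_crux (h : AxisymmetricKatoGlobal) :
    NoAxisymMinimalBlowupDatum := by
  intro ν hν ⟨u₀, g, hmin, hax⟩
  obtain ⟨hL3, hrep, hdiv, -, hnot⟩ := hmin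
  exact hnot (h ν hν u₀ g hL3 hrep hdiv (fun θ x => hax θ x))

/-- `closes` re-glued with W₀ in place of the crux (pure logic, same proof as the route's). -/
theorem closes_of_W0 (h₂ : MinimalDatumPFold) (h₄ : PFoldToAxisymmetric)
    (h₃ : NoAxisymMinimalBlowupDatum) : NavierStokesRegularity := by
  show Literature.NS.NavierStokesExistenceSmoothR3
  intro ν hν u₀ hsm hdiv hdec
  by_contra hno
  obtain ⟨u₁, g, hmin, hax⟩ := h₄ ν hν (h₂ ν hν ⟨u₀, hsm, hdiv, hdec, hno⟩)
  exact h₃ ν hν ⟨u₁, g, hmin, fun θ x => hax θ x⟩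

/-! ## 2. Decomposition candidates (criterion ∧ a-priori), typed over the registered line's objects

Common frame of the registered stubs: an axisymmetric Kato solution `u` of the datum on `[0,T)`,
smooth on the open strip. -/

/-- Frame predicate of the registered line (verbatim shape of `stub_swirlAxisModulus`' binders). -/
def KatoAxisymFrame (ν T : ℝ) (u₀ : ℝ³ → ℝ³)
    (g : HomSobolev ℝ³ (EuclideanSpace ℂ (Fin 3)) (1 / 2 : ℝ)) (u : ℝ → ℝ³ → ℝ³) : Prop :=
  g.Represents (Literature.Analysis.FunctionSpaces.EuclideanSpace.complexify ∘ u₀) ∧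
    IsKatoSolutionOn T ν u₀ u ∧ ContDiffOn ℝ (⊤ : ℕ∞) (uncurry u) (Ioo 0 T ×ˢ univ) ∧
    ∀ t ∈ Ioo 0 T, IsAxisymmetric (u t)

/-- The registered hard stub, as a Prop (log³ modulus of the swirl at the axis up to the top). -/
def SwirlAxisLogModulus : Prop :=
  ∀ ν : ℝ, 0 < ν → ∀ T : ℝ, 0 < T → ∀ (u₀ : ℝ³ → ℝ³)
    (g : HomSobolev ℝ³ (EuclideanSpace ℂ (Fin 3)) (1 / 2 : ℝ)) (u : ℝ → ℝ³ → ℝ³),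
    KatoAxisymFrame ν T u₀ g u → ∀ t₀ ∈ Ioo 0 T, ∃ C δ₀ : ℝ, 0 < δ₀ ∧ δ₀ < 1 ∧
      ∀ t ∈ Ico t₀ T, ∀ x : ℝ³, cylRadius x ≤ δ₀ → |swirl (u t) x| ≤ C / |Real.log (cylRadius x)| ^ 3

/-- Piece B of split D₃ (a priori, modulus-free): the swirl VANISHES at the axis uniformly up to the
top time (ν-normalised: for every ε some δ). Strictly weaker than `SwirlAxisLogModulus`. -/
def SwirlAxisUniformVanishing : Prop :=
  ∀ ν : ℝ, 0 < ν → ∀ T : ℝ, 0 < T → ∀ (u₀ : ℝ³ → ℝ³)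
    (g : HomSobolev ℝ³ (EuclideanSpace ℂ (Fin 3)) (1 / 2 : ℝ)) (u : ℝ → ℝ³ → ℝ³),
    KatoAxisymFrame ν T u₀ g u → ∀ t₀ ∈ Ioo 0 T, ∀ ε : ℝ, 0 < ε → ∃ δ : ℝ, 0 < δ ∧
      ∀ t ∈ Ico t₀ T, ∀ x : ℝ³, cylRadius x ≤ δ → |swirl (u t) x| ≤ ε * ν

/-- Piece A of split D₃ (criterion, ABSOLUTE ε): smallness of |Γ| ≤ ε ν in a thin tube around the
axis on a final time slab forces continuation (global Kato solution).  NOT in print: every printed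
small-swirl theorem is relative (Lemarié-Rieusset 2016 Thm 10.6 = Lei–Zhang) or needs a modulus
(CFZ 2017 r^d-weighted; Lei–Zhang |ln r|⁻²; Wei |ln r|^{-3/2}; Seregin 2022 ln⁻³). -/
def SmallSwirlTubeContinuation : Prop :=
  ∃ ε : ℝ, 0 < ε ∧ ∀ ν : ℝ, 0 < ν → ∀ T : ℝ, 0 < T → ∀ (u₀ : ℝ³ → ℝ³)
    (g : HomSobolev ℝ³ (EuclideanSpace ℂ (Fin 3)) (1 / 2 : ℝ)) (u : ℝ → ℝ³ → ℝ³),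
    KatoAxisymFrame ν T u₀ g u →
    (∃ t₀ ∈ Ioo 0 T, ∃ δ : ℝ, 0 < δ ∧ ∀ t ∈ Ico t₀ T, ∀ x : ℝ³, cylRadius x ≤ δ →
        |swirl (u t) x| ≤ ε * ν) →
    ∃ T' : ℝ, T < T' ∧ ∃ v : ℝ → ℝ³ → ℝ³, IsKatoSolutionOn T' ν u₀ v

/-- Glue of split D₃ at the level of "continuation past every finite top time": A ∧ B ⇒ every
axisymmetric Kato solution smooth on its open strip continues (pure logic). The remaining step to
the crux (`HasGlobalKatoSolution`) is the registered line's landed bookkeeping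
(`stub_katoAxisymSingularPoint`: no global solution ⇒ a finite-time Kato solution, smooth and
axisymmetric inside, that does NOT continue) — not re-proved here. -/
theorem continuation_of_A_B (hA : SmallSwirlTubeContinuation) (hB : SwirlAxisUniformVanishing) :
    ∀ ν : ℝ, 0 < ν → ∀ T : ℝ, 0 < T → ∀ (u₀ : ℝ³ → ℝ³)
      (g : HomSobolev ℝ³ (EuclideanSpace ℂ (Fin 3)) (1 / 2 : ℝ)) (u : ℝ → ℝ³ → ℝ³),
      KatoAxisymFrame ν T u₀ g u → ∃ T' : ℝ, T < T' ∧ ∃ v : ℝ → ℝ³ → ℝ³, IsKatoSolutionOn T' ν u₀ v := by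
  obtain ⟨ε, hε, hA⟩ := hA
  intro ν hν T hT u₀ g u hfr
  have ht₀ : T / 2 ∈ Ioo 0 T := ⟨by linarith, by linarith⟩
  obtain ⟨δ, hδ, hsmall⟩ := hB ν hν T hT u₀ g u hfr (T / 2) ht₀ ε hε
  exact hA ν hν T hT u₀ g u hfr ⟨T / 2, ht₀, δ, hδ, hsmall⟩

/-! ## 3. Strengthenings S⁺ (each implies `SwirlAxisLogModulus`; each is what the known CONDITIONAL
theorems deliver under Type-I / weak-L³ control, and none has an unconditional tool) -/

/-- S⁺₁: Hölder modulus of the swirl at the axis (what NU2012 / Seregin 2020 / Palasek–Ożański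
2022 Prop. 3.1 give UNDER u ∈ L^∞_t L^{3,∞}_x). -/
def SwirlAxisHolder : Prop :=
  ∀ ν : ℝ, 0 < ν → ∀ T : ℝ, 0 < T → ∀ (u₀ : ℝ³ → ℝ³)
    (g : HomSobolev ℝ³ (EuclideanSpace ℂ (Fin 3)) (1 / 2 : ℝ)) (u : ℝ → ℝ³ → ℝ³),
    KatoAxisymFrame ν T u₀ g u → ∀ t₀ ∈ Ioo 0 T, ∃ C α δ₀ : ℝ, 0 < α ∧ 0 < δ₀ ∧
      ∀ t ∈ Ico t₀ T, ∀ x : ℝ³, cylRadius x ≤ δ₀ → |swirl (u t) x| ≤ C * cylRadius x ^ α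

/-- S⁺₂: critical (Type-I-type) pointwise control of the velocity near the axis up to the top,
|u| ≤ C √ν … no: scale-invariant |u(t,x)| ≤ C / cylRadius x (KNSS 2009 Thm 5.3's hypothesis, under
which regularity is KNOWN — so S⁺₂ ⇒ crux by a landed theorem, and S⁺₂ itself = "axisymmetric
blow-up is Type I", excluded by nothing known). -/
def AxisTypeIBound : Prop :=
  ∀ ν : ℝ, 0 < ν → ∀ T : ℝ, 0 < T → ∀ (u₀ : ℝ³ → ℝ³)
    (g : HomSobolev ℝ³ (EuclideanSpace ℂ (Fin 3)) (1 / 2 : ℝ)) (u : ℝ → ℝ³ → ℝ³),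
    KatoAxisymFrame ν T u₀ g u → ∀ t₀ ∈ Ioo 0 T, ∃ C δ₀ : ℝ, 0 < δ₀ ∧
      ∀ t ∈ Ico t₀ T, ∀ x : ℝ³, 0 < cylRadius x → cylRadius x ≤ δ₀ → ‖u t x‖ ≤ C / cylRadius x

/-- Hölder ⇒ uniform vanishing (elementary; recorded to show B sits strictly below every S⁺). -/
theorem vanishing_of_holder (h : SwirlAxisHolder) : SwirlAxisUniformVanishing := by
  intro ν hν T hT u₀ g u hfr t₀ ht₀ ε hε
  obtain ⟨C, α, δ₀, hα, hδ₀, hmod⟩ := h ν hν T hT u₀ g u hfr t₀ ht₀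
  -- choose δ ≤ δ₀ with max C 0 * δ^α ≤ ε ν
  have hCν : 0 < ε * ν := mul_pos hε hν
  set C' : ℝ := max C 1 with hC'
  have hC'pos : 0 < C' := lt_of_lt_of_le one_pos (le_max_right _ _)
  -- δ := min δ₀ ((ε ν / C') ^ (1/α)), but keep δ < 1 as well
  set δ : ℝ := min (min δ₀ 1) ((ε * ν / C') ^ (1 / α)) with hδdef
  have hq : 0 < ε * ν / C' := div_pos hCν hC'pos
  have hδpos : 0 < δ := by
    refine lt_min (lt_min hδ₀ one_pos) ?_
    exact Real.rpow_pos_of_pos hq _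
  refine ⟨δ, hδpos, ?_⟩
  intro t ht x hx
  have hxδ₀ : cylRadius x ≤ δ₀ := hx.trans ((min_le_left _ _).trans (min_le_left _ _))
  have hr0 : 0 ≤ cylRadius x := cylRadius_nonneg x
  have hx1 : cylRadius x ≤ 1 := hx.trans ((min_le_left _ _).trans (min_le_right _ _))
  have h1 := hmod t ht x hxδ₀
  -- C r^α ≤ C' r^α ≤ C' δ^α ≤ C' (ε ν / C') = ε ν
  have hrα : cylRadius x ^ α ≤ δ ^ α := Real.rpow_le_rpow hr0 hx hα.le
  have hδα : δ ^ α ≤ ε * ν / C' := by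
    have : δ ≤ (ε * ν / C') ^ (1 / α) := min_le_right _ _
    calc δ ^ α ≤ ((ε * ν / C') ^ (1 / α)) ^ α := Real.rpow_le_rpow hδpos.le this hα.le
      _ = ε * ν / C' := by
        rw [← Real.rpow_mul hq.le, one_div_mul_cancel hα.ne', Real.rpow_one]
  have hrαnn : 0 ≤ cylRadius x ^ α := Real.rpow_nonneg hr0 _
  calc |swirl (u t) x| ≤ C * cylRadius x ^ α := h1
    _ ≤ C' * cylRadius x ^ α := by gcongr; exact le_max_left _ _
    _ ≤ C' * δ ^ α := by gcongr
    _ ≤ C' * (ε * ν / C') := by gcongr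
    _ = ε * ν := by field_simp

end Summit.NavierStokesRegularity.NavierStokesRegularity.Cruxes.AxisymmetricKatoGlobal.StrategistS16g5

end
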